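import Summits.CriticalPhenomena.SAWScalingLimit.Theses.SAWRestrictionRigidity
import Literature.Probability.RandomPlanarGeometry.ImageUnivalent

/-!
# Stub `stub_preimageSubdomain` of line `registered` (scalar / avoidance-cocycle cut), crux `Rigidity` (stmt-CriticalPhenomena-1368), route SAWRestrictionRigidity

Target: `Summits/CriticalPhenomena/SAWScalingLimit/Theorems/SAWRestrictionRigidityRigidityPreimageSubdomain.lean` (`--supports stmt-CriticalPhenomena-1368`).
-/

noncomputable section

namespace Summit.CriticalPhenomena.SAWScalingLimit.Cruxes.Rigidity.Cocycle

open MeasureTheory Set Filter Topology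
open Literature.Probability.RandomPlanarGeometry

/-- **Preimage test sub-domains** (stub 4 of line `registered`, crux `Rigidity`): under a continuous plane map `Φ` injective on `closure D` with `Φ(closure D) = closure D₂`, `Φ(D) = D₂`, marks to marks and continuous inverse on `closure D₂`, every Dobrushin sub-domain `D₂' ⊆ D₂` with the marks of `D₂` and agreeing with `D₂` near them has a preimage Dobrushin sub-domain `D' ⊆ D` with the marks of `D`, agreeing with `D` near them, `Φ(closure D') = closure D₂'`, and matching avoidance events (`MarkedDomain.image` along the inverse; Pommerenke 1992 Thm. 2.6 (i)⇒(ii)). [folklore] -/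
theorem stub_preimageSubdomain : ∀ (D D₂ : Literature.Probability.RandomPlanarGeometry.DobrushinDomain) (Φ : C(ℂ, ℂ)), Set.InjOn Φ (closure D.carrier) → Φ '' closure D.carrier = closure D₂.carrier → Φ '' D.carrier = D₂.carrier → Φ (D.pt 0) = D₂.pt 0 → Φ (D.pt 1) = D₂.pt 1 → ContinuousOn (Function.invFunOn Φ (closure D.carrier)) (closure D₂.carrier) → ∀ D₂' : Literature.Probability.RandomPlanarGeometry.DobrushinDomain, D₂'.carrier ⊆ D₂.carrier → D₂'.pt 0 = D₂.pt 0 → D₂'.pt 1 = D₂.pt 1 → (∃ ε : ℝ, 0 < ε ∧ D₂'.carrier ∩ Metric.ball (D₂.pt 0) ε = D₂.carrier ∩ Metric.ball (D₂.pt 0) ε ∧ D₂'.carrier ∩ Metric.ball (D₂.pt 1) ε = D₂.carrier ∩ Metric.ball (D₂.pt 1) ε) → ∃ D' : Literature.Probability.RandomPlanarGeometry.DobrushinDomain, D'.carrier ⊆ D.carrier ∧ D'.pt 0 = D.pt 0 ∧ D'.pt 1 = D.pt 1 ∧ (∃ ε : ℝ, 0 < ε ∧ D'.carrier ∩ Metric.ball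 (D.pt 0) ε = D.carrier ∩ Metric.ball (D.pt 0) ε ∧ D'.carrier ∩ Metric.ball (D.pt 1) ε = D.carrier ∩ Metric.ball (D.pt 1) ε) ∧ Φ '' closure D'.carrier = closure D₂'.carrier ∧ ∀ γ : Literature.Probability.RandomPlanarGeometry.CurveClass ℂ, γ.range ⊆ closure D.carrier → (γ.range ⊆ closure D'.carrier ↔ Φ '' γ.range ⊆ closure D₂'.carrier) := by
  intro D D₂ Φ hinj hcl hcar h0 h1 hΨc D₂' hsub h0' h1' hε
  -- the inverse `Ψ` of `Φ` on `closure D`, a homeomorphism `closure D₂ → closure D`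
  set Ψ : ℂ → ℂ := Function.invFunOn Φ (closure D.carrier) with hΨdef
  have hL : LeftInvOn Ψ Φ (closure D.carrier) := hinj.leftInvOn_invFunOn
  have hR : RightInvOn Ψ Φ (closure D₂.carrier) := by
    rw [← hcl]
    exact hL.rightInvOn_image
  have hΨinj : InjOn Ψ (closure D₂.carrier) := hR.injOn
  have hsubcl : closure D₂'.carrier ⊆ closure D₂.carrier := closure_mono hsub
  have hsub' : D₂'.carrier ⊆ Φ '' D.carrier := by
    rw [hcar]
    exact hsub
  -- the preimage sub-domain `D' := Ψ(D₂')`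
  set D' : DobrushinDomain := D₂'.image Ψ (hΨc.mono hsubcl) (hΨinj.mono hsubcl) with hD'def
  have hD'car : D'.carrier = Ψ '' D₂'.carrier := rfl
  have hD'sub : D'.carrier ⊆ D.carrier := by
    rw [hD'car]
    rintro _ ⟨y, hy, rfl⟩
    obtain ⟨x, hx, rfl⟩ := hsub' hy
    rw [hL (subset_closure hx)]
    exact hx
  have hD'cl : closure D'.carrier = Ψ '' closure D₂'.carrier :=
    D₂'.closure_carrier_image Ψ _ _
  have hΦD'cl : Φ '' closure D'.carrier = closure D₂'.carrier := by
    rw [hD'cl]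
    exact (hR.mono hsubcl).image_image
  -- agreement with `D` near a marked point, transported through `Φ`
  have key : ∀ (a : ℂ) (ε δ : ℝ), (∀ z, dist z a < δ → dist (Φ z) (Φ a) < ε) →
      D₂'.carrier ∩ Metric.ball (Φ a) ε = D₂.carrier ∩ Metric.ball (Φ a) ε →
      D'.carrier ∩ Metric.ball a δ = D.carrier ∩ Metric.ball a δ := by
    intro a ε δ hδ hagree
    refine (inter_subset_inter_left _ hD'sub).antisymm ?_
    rintro z ⟨hzD, hzB⟩
    refine ⟨?_, hzB⟩
    have hΦz : Φ z ∈ D₂'.carrier ∩ Metric.ball (Φ a) ε := by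
      rw [hagree]
      exact ⟨hcar ▸ mem_image_of_mem Φ hzD, hδ z hzB⟩
    rw [hD'car]
    exact ⟨Φ z, hΦz.1, hL (subset_closure hzD)⟩
  obtain ⟨ε, hε0, hA, hB⟩ := hε
  obtain ⟨δ₀, hδ₀, hδ₀Φ⟩ := Metric.continuousAt_iff.1 (Φ.continuous.continuousAt (x := D.pt 0)) ε hε0
  obtain ⟨δ₁, hδ₁, hδ₁Φ⟩ := Metric.continuousAt_iff.1 (Φ.continuous.continuousAt (x := D.pt 1)) ε hε0
  refine ⟨D', hD'sub, ?_, ?_, ⟨min δ₀ δ₁, lt_min hδ₀ hδ₁, ?_, ?_⟩, hΦD'cl, ?_⟩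
  · show Ψ (D₂'.pt 0) = D.pt 0
    rw [h0', ← h0]
    exact hL (frontier_subset_closure (D.pt_mem_frontier 0))
  · show Ψ (D₂'.pt 1) = D.pt 1
    rw [h1', ← h1]
    exact hL (frontier_subset_closure (D.pt_mem_frontier 1))
  · refine key (D.pt 0) ε (min δ₀ δ₁)
      (fun z hz ↦ hδ₀Φ (lt_of_lt_of_le hz (min_le_left _ _))) ?_
    rw [h0]
    exact hA
  · refine key (D.pt 1) ε (min δ₀ δ₁)
      (fun z hz ↦ hδ₁Φ (lt_of_lt_of_le hz (min_le_right _ _))) ?_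
    rw [h1]
    exact hB
  · intro γ hγ
    constructor
    · intro h
      rw [← hΦD'cl]
      exact image_mono h
    · intro h x hx
      have hΦx : Φ x ∈ Φ '' closure D'.carrier := by
        rw [hΦD'cl]
        exact h (mem_image_of_mem Φ hx)
      obtain ⟨y, hy, hyx⟩ := hΦx
      rw [← hinj (closure_mono hD'sub hy) (hγ hx) hyx]
      exact hy

end Summit.CriticalPhenomena.SAWScalingLimit.Cruxes.Rigidity.Cocycle

end
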